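/-
AI-produced formalisation (H21 engines group, seat eng-quad-2, 2026-08-22).  No `sorry`, no axioms
beyond Mathlib's.
-/
import Mathlib
import Literature.LinearAlgebra.TensorNetworks.QuanticsTensorTrain
import Literature.LinearAlgebra.TensorNetworks.TensorTrainSVD

/-!
# Minimal tensor-train decompositions: interface matrices, full rank, uniqueness up to gauge

For a tensor train (matrix product state with open boundary conditions) `T` with `L` sites,
cores `G_k(a)` (`r_k × r_{k+1}` matrices) and boundary vectors, the `k`-th UNFOLDING of its value
tensor factorises through the bond `k`:
`A_⟨k⟩ = P_k Q_k`, with the LEFT INTERFACE MATRIX `P_k : σ^k × r_k`,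
`P_k(s, β) = (lbdry · G_0(s_0) ⋯ G_{k-1}(s_{k-1}))_β`, and the RIGHT INTERFACE MATRIX
`Q_k : r_k × σ^{L-k}`, `Q_k(α, t) = (G_k(t_0) ⋯ G_{L-1}(t_{L-k-1}) · rbdry)_α`
[UschmajewVandereycken2020, §3.1 (21)–(23): `X^{<μ>} = G_{≤μ} G_{≥μ+1}ᵀ`].  Hence
`rank A_⟨k⟩ ≤ r_k` (`TensorTrain.rank_unfolding_le`, formalised earlier), and a representation is
called MINIMAL at the bond `k` if equality holds (such representations exist: the TT-SVD,
`exists_tensorTrain_eval_eq_rank_le`).  This file formalises the structure theory of minimal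
representations:

* the interface matrices and the factorisation (`evalUnfolding_eq_mul`), with the row recursion
  `P_{k+1}(s a, ·) = P_k(s, ·) G_k(a)` and the column recursion
  `Q_k(·, a t) = G_k(a) Q_{k+1}(·, t)`;
* the GAUGE ACTION `G_k(a) ↦ B_k G_k(a) A_{k+1}`, `B_k = A_k⁻¹`, does not change the tensor
  (`eval_gauge`) [UschmajewVandereycken2020, §3.3 (33)];
* in a representation minimal at the bond `k`, `P_k` has full column rank and `Q_k` full row rank
  (`rank_leftInterface_eq`, `rank_rightInterface_eq`); minimality at the bonds forces the left
  unfoldings `G_k^{<2>}` (rows `(α, a)`) of the cores to have full column rank and the right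
  unfoldings `G_k^{<1>}` (columns `(a, β)`) full row rank, and CONVERSELY full-rank core unfoldings
  force minimality (`rank_coreUnf₂_eq`, `rank_coreUnf₁_eq`, `rank_evalUnfolding_eq_of_cores`)
  [UschmajewVandereycken2020, §3.3: "TT-rank(X) = k if and only if rank G_μ^{<1>} = k_{μ-1},
  rank G_μ^{<2>} = k_μ"; HoltzRohwedderSchneider2011];
* UNIQUENESS UP TO GAUGE: if `T` is minimal (at every interior bond, boundary convention
  `r_0 = r_L = 1`, `lbdry = rbdry = 1`) and `T'` is ANY train with the same boundary convention
  representing the same tensor, then there are matrices `Y_k : r_k × r'_k`, `Z_k : r'_k × r_k` with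
  `Y_k Z_k = 1`, `P_k = P'_k Z_k` and `G_k(a) = Y_k G'_k(a) Z_{k+1}`
  (`exists_core_eq_mul_of_eval_eq`) — the "freedom in the choice of the matrices" theorem of
  [PerezGarciaVerstraeteWolfCiracQIC2007, Thm 2] (stated there for the canonical form, which is a
  minimal representation; here for an arbitrary minimal one); if moreover `r'_k = r_k` then the
  `Z_k` are invertible with inverses `Y_k`, i.e. the two representations differ EXACTLY by a gauge
  transformation (`exists_gauge_of_eval_eq`) [UschmajewVandereycken2020, §3.3: substituting (33) "is
  the only" non-uniqueness "in case X has exact TT rank k"; HoltzRohwedderSchneider2011];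
* over `ℝ`: LEFT-ORTHONORMAL cores (`Σ_a G_k(a)ᵀ G_k(a) = 1`) make the interface matrices
  column-orthonormal, `P_kᵀ P_k = 1` [UschmajewVandereycken2020, §3.1 (24)–(25)], right-orthonormal
  ones make `Q_k Q_kᵀ = 1`, and the cores `0, …, L-2` produced by the TT-SVD ARE left-orthonormal
  (`ttSVD_transpose_core_mul_core`), so the TT-SVD is a left-orthogonal representation
  [UschmajewVandereycken2020, §3.2] and the norm of the tensor is carried by the right interface
  (`sum_sq_eval_eq_sum_sq_rightInterface`); combining with uniqueness, EVERY minimal representation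
  is a gauge transform of the (left-orthogonal, same ranks) TT-SVD of its tensor
  (`exists_gauge_ttSVD`).

Conventions are those of `TensorTrain`
(`Literature.LinearAlgebra.TensorNetworks.QuanticsTensorTrain`):
bond dimensions `r : ℕ → ℕ`, cores `core k a : Matrix (Fin (r k)) (Fin (r (k+1))) K`, boundary
vectors `lbdry`, `rbdry`, value `eval`.  Index conventions: UV2020's `G_μ`, `μ = 1, …, d`, bond
ranks `k_μ` correspond to `core (μ-1)`, `r μ` here.

References: A. Uschmajew, B. Vandereycken, *Geometric methods on low-rank matrix and tensor
manifolds*, Ch. 9 of *Handbook of Variational Methods for Nonlinear Geometric Data* (Springer,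
2020), §3.1–§3.3 [UschmajewVandereycken2020]; D. Pérez-García, F. Verstraete, M. M. Wolf,
J. I. Cirac, *Matrix product state representations*, Quantum Inf. Comput. 7 (2007) 401–430, §3.1
Theorems 1–2 [PerezGarciaVerstraeteWolfCiracQIC2007]; S. Holtz, T. Rohwedder, R. Schneider, *On
manifolds of tensors of fixed TT-rank*, Numer. Math. 120 (2012) 701–731 (online 2011)
[HoltzRohwedderSchneider2011] (uniqueness of minimal TT decompositions up to gauge and the
full-rank parametrisation; cited through UV2020 §3.3).  The proofs below are the standard
full-rank-factorisation arguments written uniformly in the site index; they are this file's own.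

AI-produced formalisation (H21 engines group, seat eng-quad-2, 2026-08-22); no facts, no axioms
beyond Mathlib's, no `sorry`.
-/

open Matrix Finset

namespace Literature.LinearAlgebra.TensorNetworks

universe u v

/-! ### Linear-algebra preliminaries: one-sided inverses of full-rank matrices -/

section OneSidedInverses

variable {K : Type u} [Field K] {m n o : Type*} [Fintype m] [Fintype n] [Fintype o]

/-- [folklore] A matrix over a field whose rank is the number of its columns has a left inverse. -/
private theorem exists_mul_eq_one_of_rank_eq_card_col [DecidableEq m] [DecidableEq n]
    (A : Matrix m n K)
    (hA : A.rank = Fintype.card n) : ∃ B : Matrix n m K, B * A = 1 := by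
  have hker : LinearMap.ker A.mulVecLin = ⊥ := by
    have h := LinearMap.finrank_range_add_finrank_ker A.mulVecLin
    have hr : Module.finrank K (LinearMap.range A.mulVecLin) = Fintype.card n := hA
    rw [hr, Module.finrank_pi K] at h
    have h0 : Module.finrank K (LinearMap.ker A.mulVecLin) = 0 := by omega
    exact Submodule.finrank_eq_zero.mp h0
  obtain ⟨g, hg⟩ := LinearMap.exists_leftInverse_of_injective A.mulVecLin hker
  refine ⟨LinearMap.toMatrix' g, ?_⟩
  have h1 : LinearMap.toMatrix' (g.comp A.mulVecLin) = 1 := by rw [hg, LinearMap.toMatrix'_id]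
  rwa [LinearMap.toMatrix'_comp, ← Matrix.toLin'_apply', LinearMap.toMatrix'_toLin'] at h1

/-- [folklore] A matrix over a field whose rank is the number of its rows has a right inverse. -/
private theorem exists_mul_eq_one_of_rank_eq_card_row [DecidableEq m] [DecidableEq n]
    (A : Matrix m n K)
    (hA : A.rank = Fintype.card m) : ∃ B : Matrix n m K, A * B = 1 := by
  obtain ⟨B, hB⟩ := exists_mul_eq_one_of_rank_eq_card_col Aᵀ (by rw [Matrix.rank_transpose, hA])
  refine ⟨Bᵀ, ?_⟩
  have := congrArg Matrix.transpose hB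
  simpa only [Matrix.transpose_mul, Matrix.transpose_transpose, Matrix.transpose_one] using this

/-- [folklore] A matrix with a left inverse has rank the number of its columns. -/
private theorem rank_eq_card_of_left_inv [DecidableEq n] {A : Matrix m n K} {B : Matrix n m K}
    (h : B * A = 1) :
    A.rank = Fintype.card n := by
  refine le_antisymm (Matrix.rank_le_card_width A) ?_
  have := Matrix.rank_mul_le_right B A
  rwa [h, Matrix.rank_one] at this

/-- [folklore] A matrix with a right inverse has rank the number of its rows. -/
private theorem rank_eq_card_of_right_inv [DecidableEq m] {A : Matrix m n K} {B : Matrix n m K}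
    (h : A * B = 1) :
    A.rank = Fintype.card m := by
  refine le_antisymm (Matrix.rank_le_card_height A) ?_
  have := Matrix.rank_mul_le_left A B
  rwa [h, Matrix.rank_one] at this

/-- [folklore] The product of a left-invertible `m × n` and a right-invertible `n × o` matrix has
rank `n`. -/
private theorem rank_mul_eq_card [DecidableEq n] {A : Matrix m n K} {A' : Matrix n m K}
    {C : Matrix n o K}
    {C' : Matrix o n K} (hA : A' * A = 1) (hC : C * C' = 1) :
    (A * C).rank = Fintype.card n := by
  refine le_antisymm ((Matrix.rank_mul_le_left A C).trans (Matrix.rank_le_card_width A)) ?_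
  have h1 : A' * (A * C) * C' = 1 := by rw [← Matrix.mul_assoc, hA, Matrix.one_mul, hC]
  calc Fintype.card n = (A' * (A * C) * C').rank := by rw [h1, Matrix.rank_one]
    _ ≤ (A' * (A * C)).rank := Matrix.rank_mul_le_left _ _
    _ ≤ (A * C).rank := Matrix.rank_mul_le_right _ _

end OneSidedInverses

namespace TensorTrain

/-! ### Interface matrices and the factorisation of the unfoldings -/

section Interfaces

variable {K : Type u} [CommSemiring K] {σ : Type v} {L : ℕ} (T : TensorTrain K σ L)

/-- The `k`-th UNFOLDING `A_⟨k⟩` of the value tensor of the train (`k + m = L`): the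
`σ^k × σ^m` matrix `(s, t) ↦ T(s t)` (first `k` legs = row index, last `m` legs = column index).
[cite: UschmajewVandereycken2020, §3.1 (23)] -/
def evalUnfolding (k m : ℕ) (h : k + m = L) : Matrix (Fin k → σ) (Fin m → σ) K :=
  Matrix.of fun s t => T.eval (fun i => Fin.append s t (i.cast h.symm))

/-- The LEFT INTERFACE MATRIX `P_k = G_{≤k}` (`σ^k × r_k`):
`P_k(s, β) = (lbdry · G_0(s_0) ⋯ G_{k-1}(s_{k-1}))_β`.
[cite: UschmajewVandereycken2020, §3.1 (21)] -/
def leftInterface (k : ℕ) : Matrix (Fin k → σ) (Fin (T.r k)) K :=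
  Matrix.of fun s β => (T.lbdry ᵥ* T.leftProd k s) β

/-- The vector `G_k(t_0) G_{k+1}(t_1) ⋯ G_{L-1}(t_{m-1}) · rbdry ∈ K^{r_k}` (`k + m = L`), by
recursion on the number `m` of remaining sites.  [cite: UschmajewVandereycken2020, §3.1 (22)] -/
def tailVec : (m k : ℕ) → k + m = L → (Fin m → σ) → Fin (T.r k) → K
  | 0, _, h, _ => fun α => T.rbdry (α.cast (congrArg T.r h))
  | m + 1, k, h, t => T.core k (t 0) *ᵥ tailVec m (k + 1) (by omega) (Fin.tail t)

/-- The RIGHT INTERFACE MATRIX `Q_k = G_{≥k+1}ᵀ` (`r_k × σ^m`, `k + m = L`):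
`Q_k(α, t) = (G_k(t_0) ⋯ G_{L-1}(t_{m-1}) · rbdry)_α`.
[cite: UschmajewVandereycken2020, §3.1 (22)] -/
def rightInterface (k m : ℕ) (h : k + m = L) : Matrix (Fin (T.r k)) (Fin m → σ) K :=
  Matrix.of fun α t => T.tailVec m k h t α

/-- Definitional unfolding.  [cite: UschmajewVandereycken2020, §3.1 (23)] -/
@[simp] theorem evalUnfolding_apply (k m : ℕ) (h : k + m = L) (s : Fin k → σ) (t : Fin m → σ) :
    T.evalUnfolding k m h s t = T.eval (fun i => Fin.append s t (i.cast h.symm)) := rfl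

/-- Definitional unfolding.  [cite: UschmajewVandereycken2020, §3.1 (21)] -/
theorem leftInterface_apply (k : ℕ) (s : Fin k → σ) (β : Fin (T.r k)) :
    T.leftInterface k s β = (T.lbdry ᵥ* T.leftProd k s) β := rfl

/-- `P_0` is the row vector `lbdry`.  [cite: UschmajewVandereycken2020, §3.1 (21)] -/
theorem leftInterface_zero (s : Fin 0 → σ) (β : Fin (T.r 0)) :
    T.leftInterface 0 s β = T.lbdry β := by
  simp [leftInterface]

/-- ROW RECURSION OF THE LEFT INTERFACE: `P_{k+1}(s a, ·) = P_k(s, ·) G_k(a)`.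
[cite: UschmajewVandereycken2020, §3.1 (21)] -/
theorem leftInterface_snoc (k : ℕ) (s : Fin k → σ) (a : σ) (β : Fin (T.r (k + 1))) :
    T.leftInterface (k + 1) (Fin.snoc s a) β = (T.leftInterface k * T.core k a) s β := by
  rw [leftInterface_apply, leftProd_snoc, ← Matrix.vecMul_vecMul, Matrix.mul_apply]
  rfl

/-- `Q_L` is the column vector `rbdry`.  [cite: UschmajewVandereycken2020, §3.1 (22)] -/
theorem rightInterface_zero (k : ℕ) (h : k + 0 = L) (α : Fin (T.r k)) (t : Fin 0 → σ) :
    T.rightInterface k 0 h α t = T.rbdry (α.cast (congrArg T.r h)) := rfl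

/-- COLUMN RECURSION OF THE RIGHT INTERFACE: `Q_k(·, a t) = G_k(a) Q_{k+1}(·, t)`.
[cite: UschmajewVandereycken2020, §3.1 (22)] -/
theorem rightInterface_cons (k m : ℕ) (h : k + (m + 1) = L) (α : Fin (T.r k)) (a : σ)
    (t : Fin m → σ) :
    T.rightInterface k (m + 1) h α (Fin.cons a t) =
      (T.core k a * T.rightInterface (k + 1) m (by omega)) α t := by
  rw [Matrix.mul_apply]
  simp only [rightInterface, Matrix.of_apply, tailVec, Fin.cons_zero, Fin.tail_cons]
  rfl

/-- THE VALUE SPLITS ACROSS EVERY BOND: `T(s t) = Σ_α P_k(s, α) Q_k(α, t)` for `k + m = L`.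
[cite: UschmajewVandereycken2020, §3.1 (23)] -/
theorem eval_append (k m : ℕ) (h : k + m = L) (s : Fin k → σ) (t : Fin m → σ) :
    T.eval (fun i => Fin.append s t (i.cast h.symm)) =
      ∑ α, T.leftInterface k s α * T.rightInterface k m h α t := by
  induction m generalizing k with
  | zero =>
      obtain rfl : t = Fin.elim0 := funext fun i => i.elim0
      subst h
      simp only [Fin.append_elim0]
      show T.lbdry ⬝ᵥ (T.leftProd k s *ᵥ T.rbdry) = _
      rw [Matrix.dotProduct_mulVec]
      rfl
  | succ m ih =>
      obtain ⟨a, t, rfl⟩ : ∃ a t', t = Fin.cons a t' :=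
        ⟨t 0, Fin.tail t, (Fin.cons_self_tail t).symm⟩
      have h' : k + 1 + m = L := by omega
      have hc : (fun i : Fin L => Fin.append s (Fin.cons a t) (i.cast h.symm)) =
          fun i : Fin L => Fin.append (Fin.snoc s a) t (i.cast h'.symm) := by
        funext i
        rw [Fin.append_right_cons]
        rfl
      rw [hc, ih (k + 1) h' (Fin.snoc s a) t]
      simp only [leftInterface_snoc, rightInterface_cons, Matrix.mul_apply, Finset.sum_mul,
        Finset.mul_sum]
      rw [Finset.sum_comm]
      simp only [mul_assoc]

/-- THE UNFOLDINGS FACTORISE THROUGH THE BONDS: `A_⟨k⟩ = P_k Q_k`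
(`X^{<μ>} = G_{≤μ} G_{≥μ+1}ᵀ`).  [cite: UschmajewVandereycken2020, §3.1 (23)] -/
theorem evalUnfolding_eq_mul [Fintype σ] (k m : ℕ) (h : k + m = L) :
    T.evalUnfolding k m h = T.leftInterface k * T.rightInterface k m h := by
  ext s t
  rw [Matrix.mul_apply]
  exact T.eval_append k m h s t

/-- The value is the last interface contracted with the right boundary vector:
`T(s) = (P_L · rbdry)_s`.  [cite: UschmajewVandereycken2020, §3.1 (21)] -/
theorem eval_eq_leftInterface_mulVec (s : Fin L → σ) :
    T.eval s = (T.leftInterface L *ᵥ T.rbdry) s := by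
  rw [eval, Matrix.dotProduct_mulVec]
  rfl

end Interfaces

/-! ### The gauge action -/

section Gauge

variable {K : Type u} [CommRing K] {σ : Type v} {L : ℕ} (T : TensorTrain K σ L)

/-- THE GAUGE ACTION: insert `A_k B_k` (`= 1`) at every bond — `G_k(a) ↦ B_k G_k(a) A_{k+1}`,
`lbdry ↦ lbdry A_0`, `rbdry ↦ B_L rbdry`, bond dimensions unchanged.  With `B_k = A_k⁻¹` this is
the substitution `G_μ ↦ A_{μ-1}⁻¹ G_μ A_μ` of (33) (there `A_0 = A_d = 1`, which the boundary
vectors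
make unnecessary here).  An `abbrev`, so that the bond dimensions `(T.gauge A B).r = T.r` agree by
reducible unfolding.  [cite: UschmajewVandereycken2020, §3.3 (33)] -/
abbrev gauge (A B : (k : ℕ) → Matrix (Fin (T.r k)) (Fin (T.r k)) K) : TensorTrain K σ L where
  r := T.r
  core k a := B k * T.core k a * A (k + 1)
  lbdry := T.lbdry ᵥ* A 0
  rbdry := B L *ᵥ T.rbdry

variable (A B : (k : ℕ) → Matrix (Fin (T.r k)) (Fin (T.r k)) K)

/-- Definitional unfolding.  [cite: UschmajewVandereycken2020, §3.3 (33)] -/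
@[simp] theorem gauge_r : (T.gauge A B).r = T.r := rfl

/-- Definitional unfolding.  [cite: UschmajewVandereycken2020, §3.3 (33)] -/
@[simp] theorem gauge_core (k : ℕ) (a : σ) :
    (T.gauge A B).core k a = B k * T.core k a * A (k + 1) := rfl

/-- Definitional unfolding.  [cite: UschmajewVandereycken2020, §3.3 (33)] -/
@[simp] theorem gauge_lbdry : (T.gauge A B).lbdry = T.lbdry ᵥ* A 0 := rfl

/-- Definitional unfolding.  [cite: UschmajewVandereycken2020, §3.3 (33)] -/
@[simp] theorem gauge_rbdry : (T.gauge A B).rbdry = B L *ᵥ T.rbdry := rfl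

/-- THE PARTIAL PRODUCTS TELESCOPE under the gauge action:
`Π_{j<k} (B_j G_j(s_j) A_{j+1}) = B_0 (Π_{j<k} G_j(s_j)) A_k` when `A_j B_j = 1`.
[cite: UschmajewVandereycken2020, §3.3 (33)] -/
theorem leftProd_gauge (hAB : ∀ k, A k * B k = 1) (k : ℕ) (s : Fin k → σ) :
    (T.gauge A B).leftProd k s = B 0 * T.leftProd k s * A k := by
  induction k with
  | zero =>
      rw [leftProd_zero, leftProd_zero, Matrix.mul_one]
      exact (mul_eq_one_comm.mp (hAB 0)).symm
  | succ k ih =>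
      rw [leftProd_succ, leftProd_succ, ih, gauge_core]
      simp only [Matrix.mul_assoc]
      rw [← Matrix.mul_assoc (A k) (B k), hAB k, Matrix.one_mul]

/-- GAUGE INVARIANCE: the substitution `G_k ↦ A_k⁻¹ G_k A_{k+1}` "does not change the resulting
tensor".  [cite: UschmajewVandereycken2020, §3.3 (33)] -/
theorem eval_gauge (hAB : ∀ k, A k * B k = 1) (s : Fin L → σ) :
    (T.gauge A B).eval s = T.eval s := by
  rw [eval, eval, leftProd_gauge T A B hAB, gauge_lbdry, gauge_rbdry, Matrix.mulVec_mulVec,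
    Matrix.dotProduct_mulVec, Matrix.vecMul_vecMul]
  have h1 : A 0 * (B 0 * T.leftProd L s * A L * B L) = T.leftProd L s := by
    rw [Matrix.mul_assoc (B 0 * T.leftProd L s) (A L) (B L), hAB L, Matrix.mul_one,
      ← Matrix.mul_assoc, hAB 0, Matrix.one_mul]
  rw [h1, ← Matrix.dotProduct_mulVec]

end Gauge

/-! ### Minimal representations: full rank of the interfaces and of the core unfoldings -/

section CoreUnfoldings

variable {K : Type u} [CommSemiring K] {σ : Type v} {L : ℕ} (T : TensorTrain K σ L)

/-- The FIRST UNFOLDING `G^{<1>}` of the core at site `k`: the `r_k × (σ · r_{k+1})` matrix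
`(α, (a, β)) ↦ G_k(a)_{αβ}`.  [cite: UschmajewVandereycken2020, §3.3] -/
def coreUnf₁ (k : ℕ) : Matrix (Fin (T.r k)) (σ × Fin (T.r (k + 1))) K :=
  Matrix.of fun α q => T.core k q.1 α q.2

/-- The SECOND UNFOLDING `G^{<2>}` of the core at site `k`: the `(r_k · σ) × r_{k+1}` matrix
`((α, a), β) ↦ G_k(a)_{αβ}`.  [cite: UschmajewVandereycken2020, §3.3] -/
def coreUnf₂ (k : ℕ) : Matrix (Fin (T.r k) × σ) (Fin (T.r (k + 1))) K :=
  Matrix.of fun p β => T.core k p.2 p.1 β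

/-- Definitional unfolding.  [cite: UschmajewVandereycken2020, §3.3] -/
@[simp] theorem coreUnf₁_apply (k : ℕ) (α : Fin (T.r k)) (q : σ × Fin (T.r (k + 1))) :
    T.coreUnf₁ k α q = T.core k q.1 α q.2 := rfl

/-- Definitional unfolding.  [cite: UschmajewVandereycken2020, §3.3] -/
@[simp] theorem coreUnf₂_apply (k : ℕ) (p : Fin (T.r k) × σ) (β : Fin (T.r (k + 1))) :
    T.coreUnf₂ k p β = T.core k p.2 p.1 β := rfl

variable [Fintype σ] [DecidableEq σ]

/-- [folklore] The lifted interface `W̃ = W ⊗ 1_σ` (`σ^{k+1} × (r × σ)`, `σ^{k+1} = σ^k × σ` with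
the
LAST leg split off): `W̃_{s', (α, a)} = W_{init s', α} [s'_k = a]`. -/
private def liftRows {k r : ℕ} (W : Matrix (Fin k → σ) (Fin r) K) :
    Matrix (Fin (k + 1) → σ) (Fin r × σ) K :=
  Matrix.of fun s p => if s (Fin.last k) = p.2 then W (Fin.init s) p.1 else 0

/-- [folklore] The same lift applied to a matrix acting on the left of an interface (used for left
inverses): `Ṽ_{(α, a), s'} = V_{α, init s'} [s'_k = a]`. -/
private def liftRowsInv {k r : ℕ} (V : Matrix (Fin r) (Fin k → σ) K) :
    Matrix (Fin r × σ) (Fin (k + 1) → σ) K :=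
  Matrix.of fun p s => if s (Fin.last k) = p.2 then V p.1 (Fin.init s) else 0

/-- [folklore] The lifted right interface `1_σ ⊗ Q` (`(σ × r) × σ^{m+1}`, FIRST leg split off):
`Q̃_{(a, β), t'} = Q_{β, tail t'} [t'_0 = a]`. -/
private def liftCols {m r : ℕ} (Q : Matrix (Fin r) (Fin m → σ) K) :
    Matrix (σ × Fin r) (Fin (m + 1) → σ) K :=
  Matrix.of fun q t => if t 0 = q.1 then Q q.2 (Fin.tail t) else 0

/-- [folklore] The same lift for a matrix acting on the right of a right interface. -/
private def liftColsInv {m r : ℕ} (S : Matrix (Fin m → σ) (Fin r) K) :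
    Matrix (Fin (m + 1) → σ) (σ × Fin r) K :=
  Matrix.of fun t q => if t 0 = q.1 then S (Fin.tail t) q.2 else 0

omit [DecidableEq σ] in
/-- [folklore] A sum over `σ^{k+1}` is a sum over the last leg and the first `k`. -/
private theorem sum_eq_sum_sum_snoc {M : Type*} [AddCommMonoid M] {k : ℕ}
    (f : (Fin (k + 1) → σ) → M) : ∑ s, f s = ∑ a : σ, ∑ s : Fin k → σ, f (Fin.snoc s a) := by
  rw [← (Fin.snocEquiv fun _ : Fin (k + 1) => σ).sum_comp, Fintype.sum_prod_type]
  rfl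

omit [DecidableEq σ] in
/-- [folklore] A sum over `σ^{m+1}` is a sum over the first leg and the remaining `m`. -/
private theorem sum_eq_sum_sum_cons {M : Type*} [AddCommMonoid M] {m : ℕ}
    (f : (Fin (m + 1) → σ) → M) : ∑ t, f t = ∑ a : σ, ∑ t : Fin m → σ, f (Fin.cons a t) := by
  rw [← (Fin.consEquiv fun _ : Fin (m + 1) => σ).sum_comp, Fintype.sum_prod_type]
  rfl

/-- [folklore] MATRIX FORM OF THE ROW RECURSION: `P_{k+1} = (P_k ⊗ 1_σ) G_k^{<2>}`. -/
private theorem leftInterface_succ (k : ℕ) :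
    T.leftInterface (k + 1) = liftRows (T.leftInterface k) * T.coreUnf₂ k := by
  ext s β
  conv_lhs => rw [← Fin.snoc_init_self s]
  rw [leftInterface_snoc, Matrix.mul_apply, Matrix.mul_apply, Fintype.sum_prod_type]
  simp only [liftRows, coreUnf₂_apply, Matrix.of_apply, ite_mul, zero_mul, Finset.sum_ite_eq,
    Finset.mem_univ, if_true]

/-- [folklore] MATRIX FORM OF THE COLUMN RECURSION: `Q_k = G_k^{<1>} (1_σ ⊗ Q_{k+1})`. -/
private theorem rightInterface_succ (k m : ℕ) (h : k + (m + 1) = L) :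
    T.rightInterface k (m + 1) h =
      T.coreUnf₁ k * liftCols (T.rightInterface (k + 1) m (by omega)) := by
  ext α t
  conv_lhs => rw [← Fin.cons_self_tail t]
  rw [rightInterface_cons, Matrix.mul_apply, Matrix.mul_apply, Fintype.sum_prod_type,
    Finset.sum_comm]
  simp only [liftCols, coreUnf₁_apply, Matrix.of_apply, mul_ite, mul_zero, Finset.sum_ite_eq,
    Finset.mem_univ, if_true]

/-- [folklore] The lift of a left inverse is a left inverse of the lift:
`V W = 1 ⇒ Ṽ W̃ = 1`. -/
private theorem liftRowsInv_mul_liftRows {k r : ℕ} (V : Matrix (Fin r) (Fin k → σ) K)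
    (W : Matrix (Fin k → σ) (Fin r) K) (h : V * W = 1) : liftRowsInv V * liftRows W = 1 := by
  ext ⟨α, a⟩ ⟨β, b⟩
  have hαβ : ∑ s, V α s * W s β = if α = β then 1 else 0 := by
    simpa only [Matrix.mul_apply, Matrix.one_apply] using congrFun (congrFun h α) β
  rw [Matrix.mul_apply, sum_eq_sum_sum_snoc, Finset.sum_comm]
  simp only [liftRowsInv, liftRows, Matrix.of_apply, Fin.snoc_last, Fin.init_snoc, ite_mul,
    zero_mul, mul_ite, mul_zero, Finset.sum_ite_eq', Finset.mem_univ, if_true]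
  by_cases hab : a = b
  · subst hab
    simp [hαβ, Matrix.one_apply]
  · simp [hab, Ne.symm hab]

/-- [folklore] The lift of a right inverse is a right inverse of the lift:
`Q S = 1 ⇒ Q̃ S̃ = 1`. -/
private theorem liftCols_mul_liftColsInv {m r : ℕ} (Q : Matrix (Fin r) (Fin m → σ) K)
    (S : Matrix (Fin m → σ) (Fin r) K) (h : Q * S = 1) : liftCols Q * liftColsInv S = 1 := by
  ext ⟨a, α⟩ ⟨b, β⟩
  have hαβ : ∑ t, Q α t * S t β = if α = β then 1 else 0 := by
    simpa only [Matrix.mul_apply, Matrix.one_apply] using congrFun (congrFun h α) β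
  rw [Matrix.mul_apply, sum_eq_sum_sum_cons, Finset.sum_comm]
  simp only [liftCols, liftColsInv, Matrix.of_apply, Fin.cons_zero, Fin.tail_cons, ite_mul,
    zero_mul, mul_ite, mul_zero, Finset.sum_ite_eq', Finset.mem_univ, if_true]
  by_cases hab : a = b
  · subst hab
    simp [hαβ, Matrix.one_apply]
  · simp [hab, Ne.symm hab]

end CoreUnfoldings

section Rank

variable {K : Type u} [Field K] {σ : Type v} [Fintype σ] {L : ℕ} (T : TensorTrain K σ L)

/-- `rank A_⟨k⟩ ≤ r_k` (Theorem 12.2, necessity; = `TensorTrain.rank_unfolding_le`).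
[cite: UschmajewVandereycken2020, §3.1 Thm 12.2 (22)] -/
theorem rank_evalUnfolding_le (k m : ℕ) (h : k + m = L) : (T.evalUnfolding k m h).rank ≤ T.r k :=
  T.rank_unfolding_le k m h

/-- IN A REPRESENTATION MINIMAL AT THE BOND `k` THE LEFT INTERFACE HAS FULL COLUMN RANK:
`rank A_⟨k⟩ = r_k ⇒ rank P_k = r_k`.  [cite: UschmajewVandereycken2020, §3.3] -/
theorem rank_leftInterface_eq (k m : ℕ) (h : k + m = L)
    (hmin : (T.evalUnfolding k m h).rank = T.r k) : (T.leftInterface k).rank = T.r k := by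
  refine le_antisymm ((Matrix.rank_le_card_width _).trans_eq (Fintype.card_fin _)) ?_
  exact hmin.symm.trans_le (by rw [evalUnfolding_eq_mul]; exact Matrix.rank_mul_le_left _ _)

/-- IN A REPRESENTATION MINIMAL AT THE BOND `k` THE RIGHT INTERFACE HAS FULL ROW RANK:
`rank A_⟨k⟩ = r_k ⇒ rank Q_k = r_k`.  [cite: UschmajewVandereycken2020, §3.3] -/
theorem rank_rightInterface_eq (k m : ℕ) (h : k + m = L)
    (hmin : (T.evalUnfolding k m h).rank = T.r k) : (T.rightInterface k m h).rank = T.r k := by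
  refine le_antisymm ((Matrix.rank_le_card_height _).trans_eq (Fintype.card_fin _)) ?_
  exact hmin.symm.trans_le (by rw [evalUnfolding_eq_mul]; exact Matrix.rank_mul_le_right _ _)

variable [DecidableEq σ]

/-- MINIMALITY AT THE BOND `k + 1` FORCES THE SECOND CORE UNFOLDING AT SITE `k` TO HAVE FULL
COLUMN RANK: `rank A_⟨k+1⟩ = r_{k+1} ⇒ rank G_k^{<2>} = r_{k+1}`
(as `P_{k+1} = (P_k ⊗ 1) G_k^{<2>}`).
[cite: UschmajewVandereycken2020, §3.3] -/
theorem rank_coreUnf₂_eq (k m : ℕ) (h : k + 1 + m = L)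
    (hmin : (T.evalUnfolding (k + 1) m h).rank = T.r (k + 1)) :
    (T.coreUnf₂ k).rank = T.r (k + 1) := by
  refine le_antisymm ((Matrix.rank_le_card_width _).trans_eq (Fintype.card_fin _)) ?_
  exact (T.rank_leftInterface_eq (k + 1) m h hmin).symm.trans_le
    (by rw [leftInterface_succ]; exact Matrix.rank_mul_le_right _ _)

/-- MINIMALITY AT THE BOND `k` FORCES THE FIRST CORE UNFOLDING AT SITE `k` TO HAVE FULL ROW RANK:
`rank A_⟨k⟩ = r_k ⇒ rank G_k^{<1>} = r_k` (as `Q_k = G_k^{<1>} (1 ⊗ Q_{k+1})`).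
[cite: UschmajewVandereycken2020, §3.3] -/
theorem rank_coreUnf₁_eq (k m : ℕ) (h : k + (m + 1) = L)
    (hmin : (T.evalUnfolding k (m + 1) h).rank = T.r k) : (T.coreUnf₁ k).rank = T.r k := by
  refine le_antisymm ((Matrix.rank_le_card_height _).trans_eq (Fintype.card_fin _)) ?_
  exact (T.rank_rightInterface_eq k (m + 1) h hmin).symm.trans_le
    (by rw [T.rightInterface_succ k m h]; exact Matrix.rank_mul_le_left _ _)

omit [DecidableEq σ] in
/-- [folklore] Under the boundary convention `r_0 = 1`, `lbdry = 1`, the interface `P_0 = (1)` has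
the left inverse `(1)`. -/
private theorem exists_leftInv_leftInterface_zero (h0 : T.r 0 = 1) (hl : T.lbdry = fun _ => 1) :
    ∃ V : Matrix (Fin (T.r 0)) (Fin 0 → σ) K, V * T.leftInterface 0 = 1 := by
  refine ⟨Matrix.of fun _ _ => 1, ?_⟩
  ext α β
  haveI : Subsingleton (Fin (T.r 0)) := by rw [h0]; infer_instance
  rw [Subsingleton.elim β α]
  simp [Matrix.mul_apply, leftInterface_zero, hl]

/-- [folklore] FULL-COLUMN-RANK SECOND UNFOLDINGS AT THE SITES `< k` MAKE `P_k` LEFT INVERTIBLE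
(induction on `k` along `P_{j+1} = (P_j ⊗ 1) G_j^{<2>}`). -/
private theorem exists_leftInv_leftInterface (h0 : T.r 0 = 1) (hl : T.lbdry = fun _ => 1) (k : ℕ)
    (hc : ∀ j < k, (T.coreUnf₂ j).rank = T.r (j + 1)) :
    ∃ V : Matrix (Fin (T.r k)) (Fin k → σ) K, V * T.leftInterface k = 1 := by
  induction k with
  | zero => exact T.exists_leftInv_leftInterface_zero h0 hl
  | succ k ih =>
      obtain ⟨V, hV⟩ := ih fun j hj => hc j (by omega)
      obtain ⟨Y, hY⟩ := exists_mul_eq_one_of_rank_eq_card_col (T.coreUnf₂ k)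
        (by rw [hc k (by omega), Fintype.card_fin])
      refine ⟨Y * liftRowsInv V, ?_⟩
      rw [leftInterface_succ, Matrix.mul_assoc, ← Matrix.mul_assoc (liftRowsInv V),
        liftRowsInv_mul_liftRows V _ hV, Matrix.one_mul, hY]

/-- [folklore] FULL-ROW-RANK FIRST UNFOLDINGS AT THE SITES `≥ k` MAKE `Q_k` RIGHT INVERTIBLE
(induction on the number of remaining sites along `Q_j = G_j^{<1>} (1 ⊗ Q_{j+1})`; the base is
`Q_L = (1)` under the boundary convention `r_L = 1`, `rbdry = 1`). -/
private theorem exists_rightInv_rightInterface (hL : T.r L = 1) (hrb : T.rbdry = fun _ => 1) :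
    ∀ (m k : ℕ) (h : k + m = L), (∀ j, k ≤ j → j < L → (T.coreUnf₁ j).rank = T.r j) →
      ∃ S : Matrix (Fin m → σ) (Fin (T.r k)) K, T.rightInterface k m h * S = 1
  | 0, k, h, _ => by
      refine ⟨Matrix.of fun _ _ => 1, ?_⟩
      have hk : T.r k = 1 := by rw [show k = L by omega]; exact hL
      ext α β
      haveI : Subsingleton (Fin (T.r k)) := by rw [hk]; infer_instance
      rw [Subsingleton.elim β α]
      simp [Matrix.mul_apply, rightInterface_zero, hrb]
  | m + 1, k, h, hc => by
      obtain ⟨S, hS⟩ := exists_rightInv_rightInterface hL hrb m (k + 1) (by omega)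
        fun j hj hjL => hc j (by omega) hjL
      obtain ⟨Y, hY⟩ := exists_mul_eq_one_of_rank_eq_card_row (T.coreUnf₁ k)
        (by rw [hc k le_rfl (by omega), Fintype.card_fin])
      refine ⟨liftColsInv S * Y, ?_⟩
      rw [T.rightInterface_succ k m h, Matrix.mul_assoc, ← Matrix.mul_assoc (liftCols _),
        liftCols_mul_liftColsInv _ S hS, Matrix.one_mul, hY]

/-- FULL-RANK CORE UNFOLDINGS GIVE A MINIMAL REPRESENTATION (the converse direction of
"TT-rank(X) = k iff rank G_μ^{<1>} = k_{μ-1} and rank G_μ^{<2>} = k_μ"): under the boundary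
convention
`r_0 = r_L = 1`, `lbdry = rbdry = 1`, if the second unfoldings of the cores at the sites `< k` have
full column rank and the first unfoldings of the cores at the sites `≥ k` have full row rank, then
`rank A_⟨k⟩ = r_k`.  [cite: UschmajewVandereycken2020, §3.3] -/
theorem rank_evalUnfolding_eq_of_cores (h0 : T.r 0 = 1) (hL : T.r L = 1)
    (hl : T.lbdry = fun _ => 1) (hrb : T.rbdry = fun _ => 1) (k m : ℕ) (h : k + m = L)
    (hc₂ : ∀ j < k, (T.coreUnf₂ j).rank = T.r (j + 1))
    (hc₁ : ∀ j, k ≤ j → j < L → (T.coreUnf₁ j).rank = T.r j) :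
    (T.evalUnfolding k m h).rank = T.r k := by
  obtain ⟨V, hV⟩ := T.exists_leftInv_leftInterface h0 hl k hc₂
  obtain ⟨S, hS⟩ := T.exists_rightInv_rightInterface hL hrb m k h hc₁
  rw [evalUnfolding_eq_mul, rank_mul_eq_card hV hS, Fintype.card_fin]

/-! ### Uniqueness of minimal representations up to gauge -/

omit [Fintype σ] [DecidableEq σ] in
/-- [folklore] The row slice of a matrix indexed by `σ^{k+1}` at a fixed last leg value `a`. -/
private theorem leftInterface_snoc_eq_mul (k : ℕ) (a : σ) :
    (Matrix.of fun s β => T.leftInterface (k + 1) (Fin.snoc s a) β) =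
      T.leftInterface k * T.core k a := by
  ext s β
  exact T.leftInterface_snoc k s a β

/-- THE FREEDOM IN THE CHOICE OF THE MATRICES (Pérez-García–Verstraete–Wolf–Cirac, Theorem 2, with
the canonical form replaced by an arbitrary minimal representation): let `T` be a tensor train
with the boundary convention `r_0 = r_L = 1`, `lbdry = rbdry = 1` which is MINIMAL at every
interior bond (`rank A_⟨k⟩ = r_k`, `0 < k < L`), and let `T'` be ANY train with the same boundary
convention representing the same tensor.  Then there are matrices `Y_k : r_k × r'_k`,
`Z_k : r'_k × r_k` (`k ≤ L`) with
`Y_k Z_k = 1`, `P_k = P'_k Z_k` (left interfaces) and `G_k(a) = Y_k G'_k(a) Z_{k+1}` (`k < L`).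
Proof: with a left inverse `V_k` of `P_k` and a right inverse `R_k` of `Q_k` (full rank by
minimality) put `Z_k = Q'_k R_k`, `Y_k = V_k P'_k`; then `P'_k Z_k = A_⟨k⟩ R_k = P_k`,
`Y_k Z_k = V_k P_k = 1`, and
`G_k(a) = V_k P_k G_k(a) = V_k P_{k+1}(· a, ·) = V_k P'_{k+1}(· a, ·) Z_{k+1}
= V_k P'_k G'_k(a) Z_{k+1}`.
[cite: PerezGarciaVerstraeteWolfCiracQIC2007, Thm 2] [cite: UschmajewVandereycken2020, §3.3 (33)] -/
theorem exists_core_eq_mul_of_eval_eq (T T' : TensorTrain K σ L)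
    (h0 : T.r 0 = 1) (hL : T.r L = 1) (hl : T.lbdry = fun _ => 1) (hrb : T.rbdry = fun _ => 1)
    (h0' : T'.r 0 = 1) (hL' : T'.r L = 1) (hl' : T'.lbdry = fun _ => 1)
    (hrb' : T'.rbdry = fun _ => 1)
    (hmin : ∀ k m (h : k + m = L), 0 < k → 0 < m → (T.evalUnfolding k m h).rank = T.r k)
    (heq : ∀ s, T'.eval s = T.eval s) :
    ∃ (Y : (k : ℕ) → Matrix (Fin (T.r k)) (Fin (T'.r k)) K)
      (Z : (k : ℕ) → Matrix (Fin (T'.r k)) (Fin (T.r k)) K),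
      (∀ k ≤ L, Y k * Z k = 1) ∧ (∀ k ≤ L, T.leftInterface k = T'.leftInterface k * Z k) ∧
        ∀ k < L, ∀ a, T.core k a = Y k * T'.core k a * Z (k + 1) := by
  -- the unfoldings of the two trains agree
  have hunf : ∀ k m (h : k + m = L), T'.evalUnfolding k m h = T.evalUnfolding k m h :=
    fun k m h => Matrix.ext fun s t => heq _
  -- left inverses `V k` of `P_k` for `k < L`
  have hV : ∀ k, ∃ V : Matrix (Fin (T.r k)) (Fin k → σ) K, k < L → V * T.leftInterface k = 1 := by
    intro k
    by_cases hk : k < L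
    · rcases Nat.eq_zero_or_pos k with rfl | hk0
      · obtain ⟨V, hV⟩ := T.exists_leftInv_leftInterface_zero h0 hl
        exact ⟨V, fun _ => hV⟩
      · obtain ⟨V, hV⟩ := exists_mul_eq_one_of_rank_eq_card_col (T.leftInterface k)
          (by rw [T.rank_leftInterface_eq k (L - k) (by omega) (hmin k (L - k) (by omega) hk0
            (by omega)), Fintype.card_fin])
        exact ⟨V, fun _ => hV⟩
    · exact ⟨0, fun h => absurd h hk⟩
  choose V hV using hV
  -- right inverses `R k` of `Q_k` for `0 < k < L`
  have hR : ∀ k, ∃ R : Matrix (Fin (L - k) → σ) (Fin (T.r k)) K, ∀ (hk0 : 0 < k) (hkL : k < L),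
      T.rightInterface k (L - k) (by omega) * R = 1 := by
    intro k
    by_cases hk : 0 < k ∧ k < L
    · obtain ⟨R, hR⟩ := exists_mul_eq_one_of_rank_eq_card_row
        (T.rightInterface k (L - k) (by omega))
        (by rw [T.rank_rightInterface_eq k (L - k) (by omega) (hmin k (L - k) (by omega) hk.1
          (by omega)), Fintype.card_fin])
      exact ⟨R, fun _ _ => hR⟩
    · exact ⟨0, fun h1 h2 => absurd ⟨h1, h2⟩ hk⟩
  choose R hR using hR
  -- the matrices
  let Z : (k : ℕ) → Matrix (Fin (T'.r k)) (Fin (T.r k)) K := fun k =>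
    if hk : 0 < k ∧ k < L then T'.rightInterface k (L - k) (by omega) * R k
    else Matrix.of fun _ _ => 1
  let Y : (k : ℕ) → Matrix (Fin (T.r k)) (Fin (T'.r k)) K := fun k =>
    if k < L then V k * T'.leftInterface k else Matrix.of fun _ _ => 1
  -- (a) the interfaces are related by `Z`
  have hPZ : ∀ k ≤ L, T.leftInterface k = T'.leftInterface k * Z k := by
    intro k hkL
    by_cases hk : 0 < k ∧ k < L
    · simp only [Z, dif_pos hk]
      rw [← Matrix.mul_assoc, ← evalUnfolding_eq_mul, hunf, evalUnfolding_eq_mul,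
        Matrix.mul_assoc, hR k hk.1 hk.2, Matrix.mul_one]
    · simp only [Z, dif_neg hk]
      rcases Nat.eq_zero_or_pos k with rfl | hk0
      · ext s β
        haveI : Unique (Fin (T'.r 0)) := h0' ▸ inferInstance
        simp [Matrix.mul_apply, leftInterface_zero, hl, hl']
      · obtain rfl : k = L := by omega
        ext s β
        haveI : Unique (Fin (T.r k)) := hL ▸ inferInstance
        have h1 : T.eval s = T.leftInterface k s β := by
          rw [eval_eq_leftInterface_mulVec, Matrix.mulVec, dotProduct, Fintype.sum_unique,
            hrb, mul_one, Unique.uniq _ β]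
        have h2 : T'.eval s = ∑ α, T'.leftInterface k s α := by
          rw [eval_eq_leftInterface_mulVec, Matrix.mulVec, dotProduct]
          simp [hrb']
        rw [Matrix.mul_apply, ← h1, ← heq, h2]
        simp
  -- (b) `Y Z = 1`
  have hYZ : ∀ k ≤ L, Y k * Z k = 1 := by
    intro k hkL
    rcases lt_or_eq_of_le hkL with hk | rfl
    · simp only [Y, if_pos hk]
      rw [Matrix.mul_assoc, ← hPZ k hkL, hV k hk]
    · simp only [Y, Z, lt_irrefl, if_false, and_false, dif_neg, not_false_eq_true]
      ext α β
      haveI : Unique (Fin (T.r k)) := hL ▸ inferInstance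
      haveI : Unique (Fin (T'.r k)) := hL' ▸ inferInstance
      simp [Matrix.mul_apply, Matrix.one_apply, Unique.uniq _ α, Unique.uniq _ β]
  -- (c) the cores
  have hcore : ∀ k < L, ∀ a, T.core k a = Y k * T'.core k a * Z (k + 1) := by
    intro k hk a
    have hY : Y k = V k * T'.leftInterface k := by simp only [Y, if_pos hk]
    calc T.core k a = V k * (T.leftInterface k * T.core k a) := by
          rw [← Matrix.mul_assoc, hV k hk, Matrix.one_mul]
      _ = V k * Matrix.of fun s β => T.leftInterface (k + 1) (Fin.snoc s a) β := by
          rw [leftInterface_snoc_eq_mul]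
      _ = V k * Matrix.of fun s β => (T'.leftInterface (k + 1) * Z (k + 1)) (Fin.snoc s a) β := by
          rw [hPZ (k + 1) hk]
      _ = V k * ((Matrix.of fun s β => T'.leftInterface (k + 1) (Fin.snoc s a) β) * Z (k + 1)) := by
          rfl
      _ = Y k * T'.core k a * Z (k + 1) := by
          rw [leftInterface_snoc_eq_mul, hY]
          simp only [Matrix.mul_assoc]
  exact ⟨Y, Z, hYZ, hPZ, hcore⟩

/-- UNIQUENESS OF MINIMAL TT DECOMPOSITIONS UP TO GAUGE: if in the situation of
`exists_core_eq_mul_of_eval_eq` the second train has THE SAME bond dimensions, `r'_k = r_k`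
(`k ≤ L`), then the two representations differ exactly by a gauge transformation: there are
invertible `A_k` (inverses `B_k`; `A_k = B_k = 1` for `k > L`) with `P'_k = P_k A_k` and
`G'_k(a) = A_k⁻¹ G_k(a) A_{k+1}` — the substitution (33) "is the only" non-uniqueness of an exact
TT decomposition of minimal ranks.  (The identifications `Fin r'_k = Fin r_k` are the casts along
`r'_k = r_k`.)
[cite: UschmajewVandereycken2020, §3.3 (33)] [cite: PerezGarciaVerstraeteWolfCiracQIC2007, Thm 2] -/
theorem exists_gauge_of_eval_eq (T T' : TensorTrain K σ L)
    (h0 : T.r 0 = 1) (hL : T.r L = 1) (hl : T.lbdry = fun _ => 1) (hrb : T.rbdry = fun _ => 1)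
    (hl' : T'.lbdry = fun _ => 1) (hrb' : T'.rbdry = fun _ => 1)
    (hr : ∀ k ≤ L, T'.r k = T.r k)
    (hmin : ∀ k m (h : k + m = L), 0 < k → 0 < m → (T.evalUnfolding k m h).rank = T.r k)
    (heq : ∀ s, T'.eval s = T.eval s) :
    ∃ A B : (k : ℕ) → Matrix (Fin (T.r k)) (Fin (T.r k)) K,
      (∀ k, A k * B k = 1) ∧ (∀ k, B k * A k = 1) ∧
      (∀ k (hk : k ≤ L), T'.leftInterface k =
        (T.leftInterface k * A k).submatrix id (Fin.cast (hr k hk))) ∧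
      ∀ k (hk : k < L) (a : σ), T'.core k a =
        (B k * T.core k a * A (k + 1)).submatrix (Fin.cast (hr k hk.le))
          (Fin.cast (hr (k + 1) hk)) := by
  obtain ⟨Y, Z, hYZ, hPZ, hcore⟩ := exists_core_eq_mul_of_eval_eq T T' h0 hL hl hrb
    (by rw [hr 0 (Nat.zero_le L), h0]) (by rw [hr L le_rfl, hL]) hl' hrb' hmin heq
  have hZY : ∀ k (hk : k ≤ L), Z k * Y k = 1 := fun k hk =>
    (Matrix.mul_eq_one_comm_of_equiv (finCongr (hr k hk).symm)).mp (hYZ k hk)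
  -- the cores of `T'` in terms of those of `T`
  have hcore' : ∀ k (hk : k < L) a, T'.core k a = Z k * T.core k a * Y (k + 1) := by
    intro k hk a
    rw [hcore k hk a]
    simp only [Matrix.mul_assoc]
    rw [hZY (k + 1) hk, Matrix.mul_one, ← Matrix.mul_assoc, hZY k hk.le, Matrix.one_mul]
  have hP' : ∀ k (hk : k ≤ L), T'.leftInterface k = T.leftInterface k * Y k := by
    intro k hk
    rw [hPZ k hk, Matrix.mul_assoc, hZY k hk, Matrix.mul_one]
  refine ⟨fun k => if hk : k ≤ L then (Y k).submatrix id (Fin.cast (hr k hk).symm) else 1,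
    fun k => if hk : k ≤ L then (Z k).submatrix (Fin.cast (hr k hk).symm) id else 1,
    fun k => ?_, fun k => ?_, fun k hk => ?_, fun k hk a => ?_⟩
  · by_cases hk : k ≤ L
    · simp only [dif_pos hk]
      rw [show (Fin.cast (hr k hk).symm : Fin (T.r k) → Fin (T'.r k)) = finCongr (hr k hk).symm
        from rfl, Matrix.submatrix_mul_equiv, hYZ k hk, Matrix.submatrix_id_id]
    · simp only [dif_neg hk, Matrix.mul_one]
  · by_cases hk : k ≤ L
    · simp only [dif_pos hk]
      ext i j
      have h1 :=
        congrFun (congrFun (hZY k hk) (Fin.cast (hr k hk).symm i)) (Fin.cast (hr k hk).symm j)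
      rw [Matrix.mul_apply] at h1 ⊢
      simp only [Matrix.submatrix_apply, id_eq, Matrix.one_apply, Fin.cast_inj] at h1 ⊢
      exact h1
    · simp only [dif_neg hk, Matrix.mul_one]
  · simp only [dif_pos hk]
    ext s j
    rw [hP' k hk]
    simp only [Matrix.submatrix_apply, id_eq, Matrix.mul_apply, Fin.cast_cast, Fin.cast_eq_self]
  · simp only [dif_pos hk.le, dif_pos (show k + 1 ≤ L from hk)]
    ext i j
    rw [hcore' k hk a]
    simp only [Matrix.submatrix_apply, Matrix.mul_apply, id_eq, Fin.cast_cast, Fin.cast_eq_self]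


end Rank

/-! ### Orthogonal gauges (real scalars) -/

section Orthogonal

variable {σ : Type v} [Fintype σ] {L : ℕ} (T : TensorTrain ℝ σ L)

/-- LEFT-ORTHONORMAL CORES GIVE LEFT INTERFACES WITH ORTHONORMAL COLUMNS ((24)–(25), left half):
if `r_0 = 1`, `lbdry = 1` and the cores `j < k` are left-orthonormal, `Σ_a G_j(a)ᵀ G_j(a) = 1`
(i.e. the unfolding `G_j^{<2>}` has orthonormal columns), then `P_kᵀ P_k = 1` — "these
orthogonality conditions inductively imply" each other along the row recursion
`P_{k+1} = (P_k ⊗ 1) G_k^{<2>}`.  [cite: UschmajewVandereycken2020, §3.1 (24)-(25)] -/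
theorem transpose_leftInterface_mul_self (h0 : T.r 0 = 1) (hl : T.lbdry = fun _ => 1) :
    ∀ k : ℕ, (∀ j < k, ∑ a, (T.core j a)ᵀ * T.core j a = 1) →
      (T.leftInterface k)ᵀ * T.leftInterface k = 1
  | 0, _ => by
      ext α β
      haveI : Unique (Fin (T.r 0)) := h0 ▸ inferInstance
      simp [Matrix.mul_apply, leftInterface_zero, hl, Matrix.one_apply, Unique.uniq _ α,
        Unique.uniq _ β]
  | k + 1, horth => by
      have ih := transpose_leftInterface_mul_self h0 hl k fun j hj => horth j (by omega)
      ext β β'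
      rw [Matrix.mul_apply, sum_eq_sum_sum_snoc]
      simp only [Matrix.transpose_apply, leftInterface_snoc]
      have hstep : ∀ a, ∑ s, (T.leftInterface k * T.core k a) s β *
          (T.leftInterface k * T.core k a) s β' = ((T.core k a)ᵀ * T.core k a) β β' := by
        intro a
        calc ∑ s, (T.leftInterface k * T.core k a) s β * (T.leftInterface k * T.core k a) s β'
            = ((T.leftInterface k * T.core k a)ᵀ * (T.leftInterface k * T.core k a)) β β' := by
              rw [Matrix.mul_apply]; rfl
          _ = ((T.core k a)ᵀ * T.core k a) β β' := by
              rw [Matrix.transpose_mul, Matrix.mul_assoc, ← Matrix.mul_assoc (T.leftInterface k)ᵀ,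
                ih, Matrix.one_mul]
      simp only [hstep]
      rw [← Matrix.sum_apply]
      exact congrFun (congrFun (horth k (Nat.lt_succ_self k)) β) β'

/-- RIGHT-ORTHONORMAL CORES GIVE RIGHT INTERFACES WITH ORTHONORMAL ROWS ((24)–(25), right half):
if `r_L = 1`, `rbdry = 1` and the cores `k ≤ j < L` are right-orthonormal,
`Σ_a G_j(a) G_j(a)ᵀ = 1` (the unfolding `G_j^{<1>}` has orthonormal rows), then `Q_k Q_kᵀ = 1`.
[cite: UschmajewVandereycken2020, §3.1 (24)-(25)] -/
theorem rightInterface_mul_transpose_self (hL : T.r L = 1) (hrb : T.rbdry = fun _ => 1) :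
    ∀ (m k : ℕ) (h : k + m = L), (∀ j, k ≤ j → j < L → ∑ a, T.core j a * (T.core j a)ᵀ = 1) →
      T.rightInterface k m h * (T.rightInterface k m h)ᵀ = 1
  | 0, k, h, _ => by
      have hk : T.r k = 1 := by rw [show k = L by omega]; exact hL
      ext α β
      haveI : Unique (Fin (T.r k)) := hk ▸ inferInstance
      simp [Matrix.mul_apply, rightInterface_zero, hrb, Matrix.one_apply, Unique.uniq _ α,
        Unique.uniq _ β]
  | m + 1, k, h, horth => by
      have ih := rightInterface_mul_transpose_self hL hrb m (k + 1) (by omega)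
        fun j hj hjL => horth j (by omega) hjL
      ext α α'
      rw [Matrix.mul_apply, sum_eq_sum_sum_cons]
      simp only [Matrix.transpose_apply, rightInterface_cons]
      have hstep : ∀ a, ∑ t, (T.core k a * T.rightInterface (k + 1) m (by omega)) α t *
          (T.core k a * T.rightInterface (k + 1) m (by omega)) α' t =
            (T.core k a * (T.core k a)ᵀ) α α' := by
        intro a
        calc ∑ t, (T.core k a * T.rightInterface (k + 1) m (by omega)) α t *
              (T.core k a * T.rightInterface (k + 1) m (by omega)) α' t
            = ((T.core k a * T.rightInterface (k + 1) m (by omega)) *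
                (T.core k a * T.rightInterface (k + 1) m (by omega))ᵀ) α α' := by
              rw [Matrix.mul_apply]; rfl
          _ = (T.core k a * (T.core k a)ᵀ) α α' := by
              rw [Matrix.transpose_mul, Matrix.mul_assoc,
                ← Matrix.mul_assoc (T.rightInterface (k + 1) m (by omega)), ih, Matrix.one_mul]
      simp only [hstep]
      rw [← Matrix.sum_apply]
      exact congrFun (congrFun (horth k le_rfl (by omega)) α) α'

/-- [folklore] Multiplying by a matrix with orthonormal columns preserves the Frobenius norm:
`Pᵀ P = 1 ⟹ ‖P Q‖_F² = ‖Q‖_F²`. -/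
private theorem sum_sq_mul_of_transpose_mul_self {m n o : Type*} [Fintype m] [Fintype n]
    [DecidableEq n] [Fintype o] (P : Matrix m n ℝ) (Q : Matrix n o ℝ) (h : Pᵀ * P = 1) :
    ∑ i, ∑ j, (P * Q) i j ^ 2 = ∑ a, ∑ j, Q a j ^ 2 := by
  calc ∑ i, ∑ j, (P * Q) i j ^ 2 = ∑ j, ((P * Q)ᵀ * (P * Q)) j j := by
        rw [Finset.sum_comm]
        refine Finset.sum_congr rfl fun j _ => ?_
        rw [Matrix.mul_apply]
        simp [pow_two]
    _ = ∑ j, (Qᵀ * Q) j j := by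
        rw [Matrix.transpose_mul, Matrix.mul_assoc, ← Matrix.mul_assoc Pᵀ, h, Matrix.one_mul]
    _ = ∑ a, ∑ j, Q a j ^ 2 := by
        rw [Finset.sum_comm]
        refine Finset.sum_congr rfl fun j _ => ?_
        rw [Matrix.mul_apply]
        simp [pow_two]

/-- [folklore] Splitting a multi-index into its first `k` and last `m` legs is a bijection
`σ^k × σ^m ≃ σ^{k+m}`. -/
private def appendEquiv' (k m : ℕ) : (Fin k → σ) × (Fin m → σ) ≃ (Fin (k + m) → σ) where
  toFun p := Fin.append p.1 p.2
  invFun u := (fun i => u (Fin.castAdd m i), fun j => u (Fin.natAdd k j))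
  left_inv p := Prod.ext (funext fun i => Fin.append_left p.1 p.2 i)
    (funext fun j => Fin.append_right p.1 p.2 j)
  right_inv _ := Fin.append_castAdd_natAdd

/-- [folklore] Summing over all multi-indices is summing over the two halves separately (the entries
of the unfolding matrix are the entries of the tensor). -/
private theorem sum_eq_sum_sum_append {M : Type*} [AddCommMonoid M] {k m N : ℕ}
    (h : k + m = N) (f : (Fin N → σ) → M) :
    ∑ u, f u = ∑ s : Fin k → σ, ∑ t : Fin m → σ, f (fun i => Fin.append s t (i.cast h.symm)) := by
  subst h
  simp only [Fin.cast_refl, id_eq]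
  rw [← Fintype.sum_prod_type']
  exact ((appendEquiv' k m).sum_comp f).symm

/-- THE NORM IS CARRIED BY THE NON-ORTHOGONALISED PART: if `r_0 = 1`, `lbdry = 1` and the cores
`j < k` are left-orthonormal, then `Σ_s T(s)² = ‖A_⟨k⟩‖_F² = ‖P_k Q_k‖_F² = ‖Q_k‖_F²` — the
Frobenius norm of the tensor equals that of the right interface matrix (the coefficient tensor
carried along by a left-to-right sweep), since `P_k` has orthonormal columns.
[cite: UschmajewVandereycken2020, §3.1 (24)] [cite: UschmajewVandereycken2020, §3.2] -/
theorem sum_sq_eval_eq_sum_sq_rightInterface (h0 : T.r 0 = 1) (hl : T.lbdry = fun _ => 1)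
    (k m : ℕ) (h : k + m = L) (horth : ∀ j < k, ∑ a, (T.core j a)ᵀ * T.core j a = 1) :
    ∑ s, T.eval s ^ 2 = ∑ α, ∑ t, T.rightInterface k m h α t ^ 2 := by
  rw [sum_eq_sum_sum_append h]
  have h1 : ∀ (s : Fin k → σ) (t : Fin m → σ),
      T.eval (fun i => Fin.append s t (i.cast h.symm)) = T.evalUnfolding k m h s t := fun _ _ => rfl
  simp only [h1, evalUnfolding_eq_mul]
  exact sum_sq_mul_of_transpose_mul_self _ _ (T.transpose_leftInterface_mul_self h0 hl k horth)

end Orthogonal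

end TensorTrain

/-! ### The TT-SVD is in left-orthogonal gauge; uniqueness applied to the TT-SVD -/

section SweepGauge

variable {σ : Type v} [Fintype σ]

/-- The right boundary vector of a swept train with at least one site is `1`.
[cite: Oseledets2011, §2] -/
theorem ttSweep_rbdry (sel : SelectionRule σ) :
    ∀ (n k r : ℕ) (C : Fin r → (Fin n → σ) → ℝ), 0 < n → (ttSweep sel k n r C).1.rbdry = fun _ => 1
  | 0, _, _, _, h => absurd h (lt_irrefl 0)
  | 1, _, _, _, _ => rfl
  | n + 2, k, _, _, _ => by
      rw [ttSweep]
      exact ttSweep_rbdry sel (n + 1) (k + 1) _ _ (Nat.succ_pos n)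

/-- [folklore] Reshaping a matrix `U` with orthonormal columns and rows indexed by `(α, a)` into
the matrices `G(a)_{αβ} = U_{(α,a)β}` gives a left-orthonormal family: `Σ_a G(a)ᵀ G(a) = Uᵀ U = 1`
(with the column index transported along `q' = q`). -/
private theorem sum_transpose_mul_self_reshape {r q q' : ℕ} (U : Matrix (Fin r × σ) (Fin q) ℝ)
    (hU : Uᵀ * U = 1) (h : q' = q) :
    ∑ a, (Matrix.of fun α (β : Fin q') =>
        (Matrix.of fun α' β' => U (α', a) β' : Matrix (Fin r) (Fin q) ℝ) α (β.cast h))ᵀ *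
      (Matrix.of fun α (β : Fin q') =>
        (Matrix.of fun α' β' => U (α', a) β' : Matrix (Fin r) (Fin q) ℝ) α (β.cast h)) = 1 := by
  subst h
  ext β β'
  have h1 := congrFun (congrFun hU β) β'
  rw [Matrix.mul_apply, Fintype.sum_prod_type] at h1
  rw [Matrix.sum_apply]
  simp only [Matrix.mul_apply, Matrix.transpose_apply, Matrix.of_apply, Fin.cast_eq_self] at h1 ⊢
  rw [Finset.sum_comm]
  exact h1

/-- A SWEEP WITH ORTHONORMAL SELECTIONS PRODUCES LEFT-ORTHONORMAL CORES: if the selection rule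
always returns matrices `U` with orthonormal columns, `Uᵀ U = 1`, then every core but the last of
the swept train is left-orthonormal, `Σ_a G_j(a)ᵀ G_j(a) = 1` (`j + 1 < n`) — the new core at
each step IS `U` reshaped, `G(a)_{αβ} = U_{(α,a)β}`.  (The last core carries the remaining
coefficients and is not normalised.)
[cite: UschmajewVandereycken2020, §3.2] [cite: Oseledets2011, §2] -/
theorem ttSweep_transpose_core_mul_core (sel : SelectionRule σ)
    (hsel : ∀ k r m (M : Matrix (Fin r × σ) (Fin m → σ) ℝ),
      (sel k r m M).2ᵀ * (sel k r m M).2 = 1) :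
    ∀ (n k r : ℕ) (C : Fin r → (Fin n → σ) → ℝ) (j : ℕ), j + 1 < n →
      ∑ a, ((ttSweep sel k n r C).1.core j a)ᵀ * (ttSweep sel k n r C).1.core j a = 1
  | 0, _, _, _, _, hj => absurd hj (by omega)
  | 1, _, _, _, _, hj => absurd hj (by omega)
  | n + 2, k, r, C, 0, _ => by
      have hc := (ttSweep sel (k + 1) (n + 1) (sel k r (n + 1) (stepMatrix C)).1
        ((sel k r (n + 1) (stepMatrix C)).2ᵀ * stepMatrix C :
          Matrix (Fin (sel k r (n + 1) (stepMatrix C)).1) (Fin (n + 1) → σ) ℝ)).2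
      rw [ttSweep]
      exact sum_transpose_mul_self_reshape _ (hsel k r (n + 1) (stepMatrix C)) hc
  | n + 2, k, r, C, j + 1, hj => by
      rw [ttSweep]
      exact ttSweep_transpose_core_mul_core sel hsel (n + 1) (k + 1) _ _ j (by omega)

section TTSVD

variable [DecidableEq σ] (rk : ℕ → ℕ) {L : ℕ} (A : (Fin L → σ) → ℝ)

/-- The TT-SVD (of a tensor with at least one leg) has right boundary vector `1`.
[cite: Oseledets2011, §2] -/
theorem ttSVD_rbdry (hL : 0 < L) : (ttSVD rk A).rbdry = fun _ => 1 :=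
  ttSweep_rbdry (svdSel rk) L 0 1 _ hL

/-- THE TT-SVD IS IN LEFT-ORTHOGONAL (`d`-ORTHOGONAL) GAUGE: every core but the last is
left-orthonormal, `Σ_a G_j(a)ᵀ G_j(a) = 1` for `j + 1 < L` ("the result will be a tensor … in
d-orthogonal TT format").  [cite: UschmajewVandereycken2020, §3.2] [cite: Oseledets2011, §2] -/
theorem ttSVD_transpose_core_mul_core (j : ℕ) (hj : j + 1 < L) :
    ∑ a, ((ttSVD rk A).core j a)ᵀ * (ttSVD rk A).core j a = 1 :=
  ttSweep_transpose_core_mul_core (svdSel rk) (fun k r m M => (svdSel_spec rk k r m M).2.1) L 0 1 _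
    j hj

/-- Consequently the left interface matrices `P_k = U_{≤k}` (`k < L`) of the TT-SVD have ORTHONORMAL
COLUMNS, `P_kᵀ P_k = 1`.
[cite: UschmajewVandereycken2020, §3.2] [cite: UschmajewVandereycken2020, §3.1 (24)] -/
theorem ttSVD_transpose_leftInterface_mul_self (k : ℕ) (hk : k < L) :
    ((ttSVD rk A).leftInterface k)ᵀ * (ttSVD rk A).leftInterface k = 1 :=
  (ttSVD rk A).transpose_leftInterface_mul_self (ttSVD_r_zero rk A) (ttSVD_lbdry rk A) k
    fun j hj => ttSVD_transpose_core_mul_core rk A j (by omega)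

end TTSVD

/-- EVERY MINIMAL TT DECOMPOSITION IS A GAUGE TRANSFORM OF THE TT-SVD: let `T` (at least one site,
boundary convention `r_0 = r_L = 1`, `lbdry = rbdry = 1`) be minimal at every interior bond,
`rank A_⟨k⟩ = r_k`.  Then the TT-SVD of the tensor `T.eval` with target ranks `r_k` has EXACTLY the
bond dimensions `r_k`, represents the same tensor, and differs from `T` by a gauge transformation
(33): `P^{SVD}_k = P_k A_k`, `G^{SVD}_k(a) = A_k⁻¹ G_k(a) A_{k+1}` with invertible `A_k` — so, by
`ttSVD_transpose_leftInterface_mul_self`, every minimal decomposition can be brought to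
left-orthogonal gauge without changing ranks or tensor.
[cite: UschmajewVandereycken2020, §3.3 (33)] [cite: UschmajewVandereycken2020, §3.2]
[cite: PerezGarciaVerstraeteWolfCiracQIC2007, Thm 2] -/
theorem TensorTrain.exists_gauge_ttSVD [DecidableEq σ] {L : ℕ} (T : TensorTrain ℝ σ L)
    (hL0 : 0 < L)
    (h0 : T.r 0 = 1) (hL : T.r L = 1) (hl : T.lbdry = fun _ => 1) (hrb : T.rbdry = fun _ => 1)
    (hmin : ∀ k m (h : k + m = L), 0 < k → 0 < m → (T.evalUnfolding k m h).rank = T.r k) :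
    ∃ (hr : ∀ k ≤ L, (ttSVD T.r T.eval).r k = T.r k)
      (A B : (k : ℕ) → Matrix (Fin (T.r k)) (Fin (T.r k)) ℝ),
      (∀ s, (ttSVD T.r T.eval).eval s = T.eval s) ∧
      (∀ k, A k * B k = 1) ∧ (∀ k, B k * A k = 1) ∧
      (∀ k (hk : k ≤ L), (ttSVD T.r T.eval).leftInterface k =
        (T.leftInterface k * A k).submatrix id (Fin.cast (hr k hk))) ∧
      ∀ k (hk : k < L) (a : σ), (ttSVD T.r T.eval).core k a =
        (B k * T.core k a * A (k + 1)).submatrix (Fin.cast (hr k hk.le))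
          (Fin.cast (hr (k + 1) hk)) := by
  have heq : ∀ s, (ttSVD T.r T.eval).eval s = T.eval s := fun s =>
    eval_ttSVD_eq T.r T.eval (fun k m h _ _ => T.rank_unfolding_le k m h) s
  have hr : ∀ k ≤ L, (ttSVD T.r T.eval).r k = T.r k := by
    intro k hk
    rcases Nat.eq_zero_or_pos k with rfl | hk0
    · rw [ttSVD_r_zero, h0]
    · rcases lt_or_eq_of_le hk with hkL | rfl
      · refine le_antisymm (ttSVD_r_le T.r T.eval k hk0 hkL) ?_
        have h1 := (ttSVD T.r T.eval).rank_evalUnfolding_le k (L - k) (by omega)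
        rw [show (ttSVD T.r T.eval).evalUnfolding k (L - k) (by omega) =
            T.evalUnfolding k (L - k) (by omega) from Matrix.ext fun s t => heq _,
          hmin k (L - k) (by omega) hk0 (by omega)] at h1
        exact h1
      · rw [ttSVD_r_last T.r T.eval hL0, hL]
  obtain ⟨A, B, hAB, hBA, hP, hG⟩ := T.exists_gauge_of_eval_eq (ttSVD T.r T.eval) h0 hL hl hrb
    (ttSVD_lbdry T.r T.eval) (ttSVD_rbdry T.r T.eval hL0) hr hmin heq
  exact ⟨hr, A, B, heq, hAB, hBA, hP, hG⟩

end SweepGauge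

end Literature.LinearAlgebra.TensorNetworks
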